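import Mathlib
import HarnessLib
import Literature.MathematicalPhysics.QuantumFieldTheory.Sweep1
import Literature.MathematicalPhysics.QuantumFieldTheory.StrongCouplingClustering

/-!
# `CurvatureKernelBound` — brick `SwapHankelLogConvex` of lead c10's swap-mirror programme toward `Stub.FiniteCouplingStrongSubextensive`
# (crux stmt-QuantumFields-11687, line `coupling-trichotomy`, skeleton v9)

Positive-semidefiniteness of the Hankel kernel produced by a coordinate-swap reflection.

Write `θ x = x ∘ swap i j` on sites of `ℤ⁴`, `Θ U = fun e => U (e.1 ∘ swap i j, swap i j e.2)` on
gauge configurations, `v = eᵢ - eⱼ` (so `θ v = -v`) and `τ_w` for the lattice translation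
`ZdGaugeConfig.translate w`.  Assume finite-volume reflection positivity
`0 ≤ ⟨Y · Y ∘ Θ⟩_{Λ_L,β}` for bounded measurable local observables `Y` living in the closed half
space `{x j ≤ x i}` (hypothesis `hRP`), a bounded measurable local observable `X` in that half
space, and box limits `⟨X ∘ τ_{mv}⟩ → x̄`, `⟨X ∘ Θ ∘ τ_{-nv}⟩ → x̄`,
`⟨(X ∘ τ_{mv}) · (X ∘ Θ ∘ τ_{-nv})⟩ → P (m + n)`.  Then `G m := P m - x̄²` is a positive
semidefinite Hankel sequence, `0 ≤ ∑_{m,n ≤ M} c m c n G (m + n)`; in particular `0 ≤ G (2u)` and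
`G (2u)² ≤ G (2u - 2) G (2u + 2)` (the `2 × 2` principal minors), i.e. `u ↦ G (2u)` is log-convex.

Proof: feed `Y U = ∑_{m ≤ M} c m (X (τ_{mv} U) - x̄)` into `hRP`; the identity
`τ_{nv} (Θ U) = Θ (τ_{-nv} U)` (because `v ∘ swap i j = -v`) identifies `Y ∘ Θ`, linearity of the
finite-volume expectation (a probability measure, or the zero measure for a degenerate
normalisation, in which case the quadratic form is `(∑ c m)² x̄² ≥ 0`) expands
`⟨Y · Y ∘ Θ⟩`, and the three box limits pass to `L → ∞`.  The minors follow by choosing `c`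
supported on one or two indices and `discrim_le_zero`.
-/

noncomputable section

open scoped BigOperators Topology
open MeasureTheory Filter Set
open Literature.MathematicalPhysics.QuantumFieldTheory Literature.Probability.LatticeModels

namespace Summit.QuantumFields.YangMills.Theorems.CurvatureKernel

/-- The pencil direction `v = eᵢ - eⱼ` is odd under the coordinate swap: `v (swap i j k) = -v k`
(also when `i = j`, where both sides vanish). [folklore] -/
theorem swap_pencil_apply {ι : Type*} [DecidableEq ι] (i j k : ι) :
    (Pi.single i (1 : ℤ) - Pi.single j (1 : ℤ) : ι → ℤ) (Equiv.swap i j k) =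
      -((Pi.single i (1 : ℤ) - Pi.single j (1 : ℤ) : ι → ℤ) k) := by
  by_cases hki : k = i
  · subst hki
    by_cases hkj : k = j
    · subst hkj; simp
    · simp [Equiv.swap_apply_left, hkj, Ne.symm hkj]
  · by_cases hkj : k = j
    · subst hkj
      simp [Equiv.swap_apply_right, hki, Ne.symm hki]
    · simp [Equiv.swap_apply_of_ne_of_ne hki hkj, hki, hkj]

/-- `v j ≤ v i` for the pencil direction `v = eᵢ - eⱼ` (`-1 ≤ 1`, or `0 ≤ 0` if `i = j`). [folklore] -/
theorem pencil_apply_le {ι : Type*} [DecidableEq ι] (i j : ι) :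
    (Pi.single i (1 : ℤ) - Pi.single j (1 : ℤ) : ι → ℤ) j ≤
      (Pi.single i (1 : ℤ) - Pi.single j (1 : ℤ) : ι → ℤ) i := by
  by_cases hij : i = j
  · subst hij; simp
  · simp [hij, Ne.symm hij]

/-- `τ_{nv} (Θ U) = Θ (τ_{-nv} U)`: translating the swap-mirrored configuration along the pencil
direction `v = eᵢ - eⱼ` is mirroring the oppositely translated configuration, because
`v ∘ swap i j = -v`. [folklore] -/
theorem translate_smul_pencil_swapConfig {G : Type*} (i j : Fin 4) (n : ℤ) (U : ZdGaugeConfig 4 G) :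
    ZdGaugeConfig.translate (n • (Pi.single i (1 : ℤ) - Pi.single j (1 : ℤ) : Site 4))
        (fun e : Literature.MathematicalPhysics.QuantumLattice.ZdEdge 4 =>
          U (e.1 ∘ Equiv.swap i j, Equiv.swap i j e.2)) =
      fun e : Literature.MathematicalPhysics.QuantumLattice.ZdEdge 4 =>
        (ZdGaugeConfig.translate (-(n • (Pi.single i (1 : ℤ) - Pi.single j (1 : ℤ) : Site 4))) U)
          (e.1 ∘ Equiv.swap i j, Equiv.swap i j e.2) := by
  funext e
  simp only [ZdGaugeConfig.translate]
  congr 1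
  ext1
  · funext k
    simp only [Function.comp_apply, Pi.add_apply, Pi.smul_apply, Pi.neg_apply, smul_eq_mul,
      swap_pencil_apply i j k]
    ring
  · rfl

/-- Lattice translation of configurations is measurable for the product `σ`-algebra
(it is precomposition with an edge map). [folklore] -/
theorem measurable_translate' {G : Type*} [MeasurableSpace G] (a : Site 4) :
    Measurable (ZdGaugeConfig.translate a : ZdGaugeConfig 4 G → ZdGaugeConfig 4 G) :=
  measurable_pi_lambda _ fun _ => measurable_pi_apply _

/-- The swap-mirror of a translate, `U ↦ Θ (τ_a U)`, is measurable for the product `σ`-algebra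
(precomposition with an edge map). [folklore] -/
theorem measurable_swapTranslate {G : Type*} [MeasurableSpace G] (i j : Fin 4) (a : Site 4) :
    Measurable (fun U : ZdGaugeConfig 4 G =>
      fun e : Literature.MathematicalPhysics.QuantumLattice.ZdEdge 4 =>
        (ZdGaugeConfig.translate a U) (e.1 ∘ Equiv.swap i j, Equiv.swap i j e.2)) :=
  measurable_pi_lambda _ fun _ => measurable_pi_apply _

/-- The free-boundary state `μ_{Λ,β} = Z⁻¹ exp(-β S_Λ) dg_∞` is either a probability measure
(`0 < Z < ∞`) or, for a degenerate normalisation `Z ∈ {0, ∞}` (possible only for discontinuous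
`ρ`), the zero measure. [folklore] -/
theorem zdWilsonMeasure_eq_zero_or_isProbabilityMeasure {N : ℕ} {G : Type*} [Group G]
    [TopologicalSpace G] [IsTopologicalGroup G] [CompactSpace G] [MeasurableSpace G] [BorelSpace G]
    (ρ : G →* Matrix (Fin N) (Fin N) ℂ) (β : ℝ) (Λ : Finset (Site 4)) :
    zdWilsonMeasure (d := 4) ρ β Λ = 0 ∨ IsProbabilityMeasure (zdWilsonMeasure (d := 4) ρ β Λ) := by
  by_cases h0 : zdPartitionFunction (d := 4) ρ β Λ = 0
  · left
    have hW : zdWilsonWeight (d := 4) ρ β Λ = 0 := Measure.measure_univ_eq_zero.mp h0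
    rw [zdWilsonMeasure, hW, smul_zero]
  by_cases htop : zdPartitionFunction (d := 4) ρ β Λ = ⊤
  · left
    rw [zdWilsonMeasure, htop, ENNReal.inv_top, zero_smul]
  · right
    constructor
    rw [zdWilsonMeasure, Measure.smul_apply, smul_eq_mul]
    exact ENNReal.inv_mul_cancel h0 htop

/-- A double sum against two one-point coefficient vectors picks out one entry. [folklore] -/
theorem sum_sum_ite_mul_ite (R : Finset ℕ) {p q : ℕ} (hp : p ∈ R) (hq : q ∈ R) (s t : ℝ)
    (g : ℕ → ℕ → ℝ) :
    ∑ m ∈ R, ∑ n ∈ R, (if m = p then s else 0) * (if n = q then t else 0) * g m n =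
      s * t * g p q := by
  rw [Finset.sum_eq_single_of_mem p hp (fun m _ hmp => by simp [hmp])]
  rw [Finset.sum_eq_single_of_mem q hq (fun n _ hnq => by simp [hnq])]
  simp

/-- The `2 × 2` quadratic form of a positive-semidefinite Hankel kernel on the indices `{p, q}`
is nonnegative. [folklore] -/
theorem hankel_two_point (Gf : ℕ → ℝ)
    (hA : ∀ (c : ℕ → ℝ) (M : ℕ), 0 ≤ ∑ m ∈ Finset.range (M + 1), ∑ n ∈ Finset.range (M + 1),
      c m * c n * Gf (m + n)) (p q : ℕ) (s t : ℝ) :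
    0 ≤ s * s * Gf (p + p) + s * t * Gf (p + q) + t * s * Gf (q + p) + t * t * Gf (q + q) := by
  have hp : p ∈ Finset.range (p + q + 1) := Finset.mem_range.2 (by omega)
  have hq : q ∈ Finset.range (p + q + 1) := Finset.mem_range.2 (by omega)
  have h := hA (fun m => (if m = p then s else 0) + (if m = q then t else 0)) (p + q)
  have hexp : ∀ m n : ℕ, ((if m = p then s else 0) + (if m = q then t else 0)) *
      ((if n = p then s else 0) + (if n = q then t else 0)) * Gf (m + n) =
      (if m = p then s else 0) * (if n = p then s else 0) * Gf (m + n) +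
      (if m = p then s else 0) * (if n = q then t else 0) * Gf (m + n) +
      (if m = q then t else 0) * (if n = p then s else 0) * Gf (m + n) +
      (if m = q then t else 0) * (if n = q then t else 0) * Gf (m + n) := by
    intro m n; ring
  simp only [hexp, Finset.sum_add_distrib, sum_sum_ite_mul_ite _ hp hp, sum_sum_ite_mul_ite _ hp hq,
    sum_sum_ite_mul_ite _ hq hp, sum_sum_ite_mul_ite _ hq hq] at h
  exact h

/-- Diagonal entries `G (2u)` of a positive-semidefinite Hankel kernel are nonnegative. [folklore] -/
theorem hankel_diag_nonneg (Gf : ℕ → ℝ)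
    (hA : ∀ (c : ℕ → ℝ) (M : ℕ), 0 ≤ ∑ m ∈ Finset.range (M + 1), ∑ n ∈ Finset.range (M + 1),
      c m * c n * Gf (m + n)) (u : ℕ) : 0 ≤ Gf (2 * u) := by
  have h := hankel_two_point Gf hA u u 1 0
  simp only [one_mul, zero_mul, mul_zero, add_zero] at h
  simpa [two_mul] using h

/-- The principal `2 × 2` minor on `{u - 1, u + 1}` of a positive-semidefinite Hankel kernel:
`G (2u)² ≤ G (2u - 2) G (2u + 2)` for `u ≥ 1` (via `discrim_le_zero`). [folklore] -/
theorem hankel_minor (Gf : ℕ → ℝ)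
    (hA : ∀ (c : ℕ → ℝ) (M : ℕ), 0 ≤ ∑ m ∈ Finset.range (M + 1), ∑ n ∈ Finset.range (M + 1),
      c m * c n * Gf (m + n)) (u : ℕ) (hu : 0 < u) :
    Gf (2 * u) ^ 2 ≤ Gf (2 * (u - 1)) * Gf (2 * (u + 1)) := by
  have h1 : u - 1 + (u - 1) = 2 * (u - 1) := by omega
  have h2 : u - 1 + (u + 1) = 2 * u := by omega
  have h3 : u + 1 + (u - 1) = 2 * u := by omega
  have h4 : u + 1 + (u + 1) = 2 * (u + 1) := by omega
  have hquad : ∀ x : ℝ, 0 ≤ Gf (2 * (u - 1)) * (x * x) + 2 * Gf (2 * u) * x + Gf (2 * (u + 1)) := by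
    intro x
    have h := hankel_two_point Gf hA (u - 1) (u + 1) x 1
    rw [h1, h2, h3, h4] at h
    nlinarith [h]
  have hd := discrim_le_zero hquad
  rw [discrim] at hd
  nlinarith [hd]

/-- **Swap-reflection Hankel positivity and log-convexity.** Given finite-volume reflection
positivity `0 ≤ ⟨Y · Y ∘ Θ⟩_{box L, β}` for the coordinate swap `Θ U e = U (e.1 ∘ swap i j, swap i j e.2)`
and all bounded measurable observables `Y` depending on finitely many links in the closed half space
`{x j ≤ x i}`, a bounded measurable observable `X` depending on links `BX` in that half space, and
box limits `⟨X ∘ τ_{mv}⟩ → x̄`, `⟨X ∘ Θ ∘ τ_{-nv}⟩ → x̄`, `⟨(X ∘ τ_{mv}) (X ∘ Θ ∘ τ_{-nv})⟩ → P (m + n)`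
along the pencil direction `v = eᵢ - eⱼ`, the sequence `G m = P m - x̄²` is a positive-semidefinite
Hankel kernel, `0 ≤ ∑_{m,n ≤ M} c m c n G (m + n)`; consequently `0 ≤ G (2u)` and
`G (2u)² ≤ G (2u - 2) G (2u + 2)` for `u ≥ 1`. [folklore] -/
theorem SwapHankelLogConvex : ∀ (N : ℕ) (G : Type) [Group G] [TopologicalSpace G] [IsTopologicalGroup G] [CompactSpace G] [MeasurableSpace G] [BorelSpace G] (ρ : G →* Matrix (Fin N) (Fin N) ℂ) (i j : Fin 4) (β : ℝ), (∀ (L : ℕ) (Y : Literature.MathematicalPhysics.QuantumFieldTheory.ZdGaugeConfig 4 G → ℝ) (B : Finset (Literature.MathematicalPhysics.QuantumLattice.ZdEdge 4)), Measurable Y → (∃ C : ℝ, ∀ U, |Y U| ≤ C) → DependsOn Y (B : Set (Literature.MathematicalPhysics.QuantumLattice.ZdEdge 4)) → (∀ e ∈ B, e.1 j ≤ e.1 i ∧ (e.1 + Pi.single e.2 (1 : ℤ) : Literature.Probability.LatticeModels.Site 4) j ≤ (e.1 + Pi.single e.2 (1 : ℤ) : Literature.Probability.LatticeModels.Site 4)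 i) → 0 ≤ Literature.MathematicalPhysics.QuantumFieldTheory.zdExpect ρ β (Literature.Probability.LatticeModels.box 4 L) (fun U => Y U * Y (fun e : Literature.MathematicalPhysics.QuantumLattice.ZdEdge 4 => (U) (e.1 ∘ Equiv.swap i j, Equiv.swap i j e.2)))) → ∀ (X : Literature.MathematicalPhysics.QuantumFieldTheory.ZdGaugeConfig 4 G → ℝ), Measurable X → (∃ C : ℝ, ∀ U, |X U| ≤ C) → ∀ (BX : Finset (Literature.MathematicalPhysics.QuantumLattice.ZdEdge 4)), DependsOn X (BX : Set (Literature.MathematicalPhysics.QuantumLattice.ZdEdge 4)) → (∀ e ∈ BX, e.1 j ≤ e.1 i ∧ (e.1 + Pi.single e.2 (1 : ℤ) : Literature.Probability.LatticeModels.Site 4) j ≤ (e.1 + Pi.single e.2 (1 : ℤ) : Literature.Probability.LatticeModels.Site 4) i) → ∀ (xbar : ℝ) (P : ℕ → ℝ), (∀ m : ℕ, Literature.Probability.LatticeModels.HasBoxLimit (fun Λ => Literature.MathematicalPhysics.QuantumFieldTheory.zdExpect ρ β Λ (X ∘ Literature.MathematicalPhysics.QuantumFieldTheory.ZdGaugeConfig.translate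 ((m : ℤ) • (Pi.single i (1 : ℤ) - Pi.single j (1 : ℤ) : Literature.Probability.LatticeModels.Site 4)))) xbar) → (∀ n : ℕ, Literature.Probability.LatticeModels.HasBoxLimit (fun Λ => Literature.MathematicalPhysics.QuantumFieldTheory.zdExpect ρ β Λ (fun U => X (fun e : Literature.MathematicalPhysics.QuantumLattice.ZdEdge 4 => (Literature.MathematicalPhysics.QuantumFieldTheory.ZdGaugeConfig.translate (-((n : ℤ) • (Pi.single i (1 : ℤ) - Pi.single j (1 : ℤ) : Literature.Probability.LatticeModels.Site 4))) U) (e.1 ∘ Equiv.swap i j, Equiv.swap i j e.2)))) xbar) → (∀ m n : ℕ, Literature.Probability.LatticeModels.HasBoxLimit (fun Λ => Literature.MathematicalPhysics.QuantumFieldTheory.zdExpect ρ β Λ (fun U => X (Literature.MathematicalPhysics.QuantumFieldTheory.ZdGaugeConfig.translate ((m : ℤ) • (Pi.single i (1 : ℤ) - Pi.single j (1 : ℤ) : Literature.Probability.LatticeModels.Site 4)) U) * X (fun e : Literature.MathematicalPhysics.QuantumLattice.ZdEdge 4 => (Literature.MathematicalPhysics.QuantumFieldTheory.ZdGaugeConfig.translate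 (-((n : ℤ) • (Pi.single i (1 : ℤ) - Pi.single j (1 : ℤ) : Literature.Probability.LatticeModels.Site 4))) U) (e.1 ∘ Equiv.swap i j, Equiv.swap i j e.2)))) (P (m + n))) → (∀ (c : ℕ → ℝ) (M : ℕ), 0 ≤ ∑ m ∈ Finset.range (M + 1), ∑ n ∈ Finset.range (M + 1), c m * c n * (P (m + n) - xbar ^ 2)) ∧ (∀ u : ℕ, 0 ≤ P (2 * u) - xbar ^ 2) ∧ ∀ u : ℕ, 0 < u → (P (2 * u) - xbar ^ 2) ^ 2 ≤ (P (2 * (u - 1)) - xbar ^ 2) * (P (2 * (u + 1)) - xbar ^ 2) := by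
  intro N G _ _ _ _ _ _ ρ i j β hRP X hXm hXb BX hXdep hBX xbar P h1 h2 h3
  have hA : ∀ (c : ℕ → ℝ) (M : ℕ), 0 ≤ ∑ m ∈ Finset.range (M + 1), ∑ n ∈ Finset.range (M + 1),
      c m * c n * (P (m + n) - xbar ^ 2) := by
    intro c M
    obtain ⟨C, hC⟩ := hXb
    -- name the translated observables and the mirrored, oppositely translated ones
    obtain ⟨F, hF⟩ : ∃ F : ℕ → ZdGaugeConfig 4 G → ℝ, ∀ m, F m =
        X ∘ ZdGaugeConfig.translate ((m : ℤ) • (Pi.single i (1 : ℤ) - Pi.single j (1 : ℤ) : Site 4)) :=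
      ⟨_, fun _ => rfl⟩
    obtain ⟨G', hG'⟩ : ∃ G' : ℕ → ZdGaugeConfig 4 G → ℝ, ∀ n, G' n = fun U =>
        X (fun e : Literature.MathematicalPhysics.QuantumLattice.ZdEdge 4 =>
          (ZdGaugeConfig.translate (-((n : ℤ) • (Pi.single i (1 : ℤ) - Pi.single j (1 : ℤ) : Site 4))) U)
            (e.1 ∘ Equiv.swap i j, Equiv.swap i j e.2)) :=
      ⟨_, fun _ => rfl⟩
    have hFm : ∀ m, Measurable (F m) := fun m => by
      rw [hF]; exact hXm.comp (measurable_translate' _)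
    have hGm : ∀ n, Measurable (G' n) := fun n => by
      rw [hG']; exact hXm.comp (measurable_swapTranslate i j _)
    have hFb : ∀ m U, |F m U| ≤ C := fun m U => by rw [hF]; exact hC _
    have hGb : ∀ n U, |G' n U| ≤ C := fun n U => by rw [hG']; exact hC _
    -- the three families of limits, restated for `F` and `G'`
    have hl1 : ∀ m, Tendsto (fun L => zdExpect ρ β (box 4 L) (F m)) atTop (𝓝 xbar) := fun m => by
      rw [hF]; exact h1 m
    have hl2 : ∀ n, Tendsto (fun L => zdExpect ρ β (box 4 L) (G' n)) atTop (𝓝 xbar) := fun n => by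
      rw [hG']; exact h2 n
    have hl3 : ∀ m n, Tendsto (fun L => zdExpect ρ β (box 4 L) (fun U => F m U * G' n U)) atTop
        (𝓝 (P (m + n))) := fun m n => by
      rw [hF, hG']; exact h3 m n
    set R := Finset.range (M + 1) with hR
    -- the finite-volume sequence converging to the Hankel quadratic form
    have ha : Tendsto (fun L => ∑ m ∈ R, ∑ n ∈ R, c m * c n *
        (zdExpect ρ β (box 4 L) (fun U => F m U * G' n U) - xbar * zdExpect ρ β (box 4 L) (F m)
          - xbar * zdExpect ρ β (box 4 L) (G' n) + xbar ^ 2)) atTop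
        (𝓝 (∑ m ∈ R, ∑ n ∈ R, c m * c n * (P (m + n) - xbar * xbar - xbar * xbar + xbar ^ 2))) := by
      refine tendsto_finsetSum _ fun m _ => tendsto_finsetSum _ fun n _ => ?_
      exact ((((hl3 m n).sub (tendsto_const_nhds.mul (hl1 m))).sub
        (tendsto_const_nhds.mul (hl2 n))).add tendsto_const_nhds).const_mul _
    have hlim : (∑ m ∈ R, ∑ n ∈ R, c m * c n * (P (m + n) - xbar * xbar - xbar * xbar + xbar ^ 2))
        = ∑ m ∈ R, ∑ n ∈ R, c m * c n * (P (m + n) - xbar ^ 2) :=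
      Finset.sum_congr rfl fun m _ => Finset.sum_congr rfl fun n _ => by ring
    rw [← hlim]
    refine ge_of_tendsto' ha fun L => ?_
    rcases zdWilsonMeasure_eq_zero_or_isProbabilityMeasure ρ β (box 4 L) with h0 | hprob
    · -- degenerate normalisation: the finite-volume state is the zero measure
      have hE : ∀ f : ZdGaugeConfig 4 G → ℝ, zdExpect ρ β (box 4 L) f = 0 := fun f => by
        simp [zdExpect, h0]
      have hcc : ∀ m n, c m * c n * (0 - xbar * 0 - xbar * 0 + xbar ^ 2) =
          (c m * xbar) * (c n * xbar) := fun m n => by ring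
      simp only [hE, hcc]
      rw [← Finset.sum_mul_sum]
      exact mul_self_nonneg _
    · -- the finite-volume state is a probability measure: use reflection positivity
      have hInt : ∀ f : ZdGaugeConfig 4 G → ℝ, Measurable f → ∀ K : ℝ, (∀ U, |f U| ≤ K) →
          Integrable f (zdWilsonMeasure (d := 4) ρ β (box 4 L)) := fun f hf K hK =>
        Integrable.of_bound hf.aestronglyMeasurable K (ae_of_all _ fun U => by
          rw [Real.norm_eq_abs]; exact hK U)
      have hIF : ∀ m, Integrable (F m) (zdWilsonMeasure (d := 4) ρ β (box 4 L)) :=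
        fun m => hInt _ (hFm m) C (hFb m)
      have hIG : ∀ n, Integrable (G' n) (zdWilsonMeasure (d := 4) ρ β (box 4 L)) :=
        fun n => hInt _ (hGm n) C (hGb n)
      have hIFG : ∀ m n, Integrable (fun U => F m U * G' n U)
          (zdWilsonMeasure (d := 4) ρ β (box 4 L)) := fun m n =>
        hInt _ ((hFm m).mul (hGm n)) (C * C) fun U => by
          rw [abs_mul]
          exact mul_le_mul (hFb m U) (hGb n U) (abs_nonneg _) ((abs_nonneg _).trans (hFb m U))
      -- the test observable fed into reflection positivity
      obtain ⟨Y, hY⟩ : ∃ Y : ZdGaugeConfig 4 G → ℝ, ∀ U, Y U = ∑ m ∈ R, c m * (F m U - xbar) :=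
        ⟨_, fun _ => rfl⟩
      have hYm : Measurable Y := by
        have : Y = fun U => ∑ m ∈ R, c m * (F m U - xbar) := funext hY
        rw [this]
        exact Finset.measurable_sum _ fun m _ => ((hFm m).sub measurable_const).const_mul _
      have hYb : ∃ C' : ℝ, ∀ U, |Y U| ≤ C' := by
        refine ⟨∑ m ∈ R, |c m| * (C + |xbar|), fun U => ?_⟩
        rw [hY]
        refine (Finset.abs_sum_le_sum_abs _ _).trans (Finset.sum_le_sum fun m _ => ?_)
        rw [abs_mul]
        refine mul_le_mul_of_nonneg_left ?_ (abs_nonneg _)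
        exact (abs_sub _ _).trans (add_le_add (hFb m U) le_rfl)
      have hYdep : DependsOn Y ((R.biUnion fun m => BX.image
          (Literature.MathematicalPhysics.QuantumLattice.edgeShift
            ((m : ℤ) • (Pi.single i (1 : ℤ) - Pi.single j (1 : ℤ) : Site 4))) :
            Finset (Literature.MathematicalPhysics.QuantumLattice.ZdEdge 4)) :
            Set (Literature.MathematicalPhysics.QuantumLattice.ZdEdge 4)) := by
        intro U V hUV
        rw [hY, hY]
        refine Finset.sum_congr rfl fun m hm => ?_
        have hFUV : F m U = F m V := by
          rw [hF]
          exact dependsOn_comp_translate hXdep _ fun e he =>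
            hUV e (Finset.mem_coe.2 (Finset.mem_biUnion.2 ⟨m, hm, Finset.mem_coe.1 he⟩))
        rw [hFUV]
      have hBY : ∀ e ∈ (R.biUnion fun m => BX.image
          (Literature.MathematicalPhysics.QuantumLattice.edgeShift
            ((m : ℤ) • (Pi.single i (1 : ℤ) - Pi.single j (1 : ℤ) : Site 4)))),
          e.1 j ≤ e.1 i ∧ (e.1 + Pi.single e.2 (1 : ℤ) : Site 4) j ≤
            (e.1 + Pi.single e.2 (1 : ℤ) : Site 4) i := by
        intro e he
        simp only [Finset.mem_biUnion, Finset.mem_image] at he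
        obtain ⟨m, -, b, hb, rfl⟩ := he
        obtain ⟨hb1, hb2⟩ := hBX b hb
        have hmv : (m : ℤ) * (Pi.single i (1 : ℤ) - Pi.single j (1 : ℤ) : Site 4) j ≤
            (m : ℤ) * (Pi.single i (1 : ℤ) - Pi.single j (1 : ℤ) : Site 4) i :=
          mul_le_mul_of_nonneg_left (pencil_apply_le i j) (Int.natCast_nonneg m)
        simp only [Literature.MathematicalPhysics.QuantumLattice.edgeShift_apply, Pi.add_apply,
          Pi.smul_apply, smul_eq_mul] at hb2 hmv ⊢
        constructor <;> linarith
      have hpos := hRP L Y _ hYm hYb hYdep hBY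
      -- the mirror image of the test observable
      have hYΘ : ∀ U : ZdGaugeConfig 4 G,
          Y (fun e : Literature.MathematicalPhysics.QuantumLattice.ZdEdge 4 =>
            U (e.1 ∘ Equiv.swap i j, Equiv.swap i j e.2)) = ∑ n ∈ R, c n * (G' n U - xbar) := by
        intro U
        rw [hY]
        refine Finset.sum_congr rfl fun n _ => ?_
        rw [hF, hG']
        simp only [Function.comp_apply]
        rw [translate_smul_pencil_swapConfig]
      have hterm : ∀ m n, (fun U => (c m * (F m U - xbar)) * (c n * (G' n U - xbar))) =
          fun U => c m * c n * (F m U * G' n U) - c m * c n * xbar * F m U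
            - c m * c n * xbar * G' n U + c m * c n * xbar ^ 2 := fun m n => by
        funext U; ring
      have hIterm : ∀ m n, Integrable (fun U => (c m * (F m U - xbar)) * (c n * (G' n U - xbar)))
          (zdWilsonMeasure (d := 4) ρ β (box 4 L)) := fun m n => by
        rw [hterm]
        exact ((((hIFG m n).const_mul _).sub' ((hIF m).const_mul _)).sub'
          ((hIG n).const_mul _)).fun_add (integrable_const _)
      have hEterm : ∀ m n, ∫ U, (c m * (F m U - xbar)) * (c n * (G' n U - xbar))
          ∂(zdWilsonMeasure (d := 4) ρ β (box 4 L)) =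
          c m * c n * (zdExpect ρ β (box 4 L) (fun U => F m U * G' n U)
            - xbar * zdExpect ρ β (box 4 L) (F m) - xbar * zdExpect ρ β (box 4 L) (G' n)
            + xbar ^ 2) := fun m n => by
        have i1 := (hIFG m n).const_mul (c m * c n)
        have i2 := (hIF m).const_mul (c m * c n * xbar)
        have i3 := (hIG n).const_mul (c m * c n * xbar)
        rw [hterm, integral_add ((i1.sub' i2).sub' i3) (integrable_const _),
          integral_sub (i1.sub' i2) i3, integral_sub i1 i2, integral_const_mul, integral_const_mul,
          integral_const_mul, integral_const]
        simp only [zdExpect, probReal_univ, one_smul]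
        ring
      have hexp : zdExpect ρ β (box 4 L) (fun U => Y U *
          Y (fun e : Literature.MathematicalPhysics.QuantumLattice.ZdEdge 4 =>
            U (e.1 ∘ Equiv.swap i j, Equiv.swap i j e.2))) =
          ∑ m ∈ R, ∑ n ∈ R, c m * c n * (zdExpect ρ β (box 4 L) (fun U => F m U * G' n U)
            - xbar * zdExpect ρ β (box 4 L) (F m) - xbar * zdExpect ρ β (box 4 L) (G' n)
            + xbar ^ 2) := by
        calc zdExpect ρ β (box 4 L) (fun U => Y U *
              Y (fun e : Literature.MathematicalPhysics.QuantumLattice.ZdEdge 4 =>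
                U (e.1 ∘ Equiv.swap i j, Equiv.swap i j e.2)))
            = ∫ U, ∑ m ∈ R, ∑ n ∈ R, (c m * (F m U - xbar)) * (c n * (G' n U - xbar))
                ∂(zdWilsonMeasure (d := 4) ρ β (box 4 L)) := by
              unfold zdExpect
              refine integral_congr_ae (ae_of_all _ fun U => ?_)
              dsimp only
              rw [hYΘ U, hY U, Finset.sum_mul_sum]
          _ = ∑ m ∈ R, ∫ U, ∑ n ∈ R, (c m * (F m U - xbar)) * (c n * (G' n U - xbar))
                ∂(zdWilsonMeasure (d := 4) ρ β (box 4 L)) :=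
              integral_finsetSum _ fun m _ => integrable_finsetSum _ fun n _ => hIterm m n
          _ = ∑ m ∈ R, ∑ n ∈ R, ∫ U, (c m * (F m U - xbar)) * (c n * (G' n U - xbar))
                ∂(zdWilsonMeasure (d := 4) ρ β (box 4 L)) :=
              Finset.sum_congr rfl fun m _ => integral_finsetSum _ fun n _ => hIterm m n
          _ = _ := Finset.sum_congr rfl fun m _ => Finset.sum_congr rfl fun n _ => hEterm m n
      rw [← hexp]
      exact hpos
  refine ⟨hA, ?_, ?_⟩
  · exact hankel_diag_nonneg (fun k => P k - xbar ^ 2) hA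
  · exact hankel_minor (fun k => P k - xbar ^ 2) hA

end Summit.QuantumFields.YangMills.Theorems.CurvatureKernel

end
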